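import Summits.NavierStokesRegularity.FluidComputer.ClayBlowupSingularSlicePacking
import Mathlib.MeasureTheory.Measure.Hausdorff
import HarnessLib

/-!
# THE SINGULAR SLICE OF A CLAY BLOW-UP IS `ℋ²`-NULL (hence Lebesgue-null): no sheet-like or
# volumetric first-time singularities for Fefferman's (C)

Cell `ns-blowup`, seat `ns-blowup-ecbridge-2` (g6; the E–C endpoint theory seat). LABEL: E–C typing
(KERNEL — no named fact). WHAT THIS IS NOT: not Navier–Stokes evidence — a necessary condition on the
TYPE `ClayBlowup ν` (no inhabitant is claimed anywhere). Companion memo: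
`run/shared/lean/pub/ns-blowup/ecbridge2/ECBRIDGE-2-MEMO-5.md` §2 (row R6⁗).

## Content (Scheffer / Caffarelli–Kohn–Nirenberg at the first blow-up time, with force)

From the finite `2r`-nets with the packing bound (`ClayBlowup.exists_finite_net_singularSlice`:
`#P · ε³r²/2 ≤ m(r)`, `m(r) → 0` by `tendsto_stripMass`) along the radii `rₙ = min r₂ (1/(n+1))`:

* `ClayBlowup.volume_singularSlice_eq_zero` — the singular slice
  `{x₀ | u is not backward bounded at (T, x₀)}` has LEBESGUE MEASURE ZERO in `ℝ³`
  (`|⋃ B̄(x, 2r)| ≤ #P · 8|B₁| r³ = (#P · ε³r²/2) · 16|B₁| r/ε³ ≤ m(r) · const`);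
* **`ClayBlowup.hausdorffMeasure_two_singularSlice_eq_zero`** — it has TWO-DIMENSIONAL HAUSDORFF MEASURE
  ZERO, `μH[2] S_T = 0` (Mathlib's `hausdorffMeasure_le_liminf_sum` with the covers
  `{B̄(x, 2rₙ)}_{x ∈ Pₙ}`: `∑ diam² ≤ #Pₙ · 16 rₙ² ≤ 32 m(rₙ)/ε³ → 0`). A breakdown scenario for (C)
  whose singular set at the blow-up time contains a piece of a surface (vortex-SHEET collapse) or a
  volume is therefore NOT a Clay blow-up; what survives is at most «one-dimensional» at the top slice
  (CKN's `𝒫¹(S) = 0` in space-time would sharpen this to `ℋ¹`; it needs their Prop. 2 at interior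
  points and is not claimed here);
* the `DesignedBlowup` twins.

References: L. Caffarelli, R. Kohn, L. Nirenberg, CPAM 35 (1982), §6 Thm. B and §1 (Scheffer's
theorems) [cite: CaffarelliKohnNirenberg1982, §6]; J. C. Robinson, J. L. Rodrigo, W. Sadowski, CUP 2016,
Thm. 16.2 [cite: RobinsonRodrigoSadowski2016, Thm. 16.2]; C. L. Fefferman, Clay problem description, (C)
[cite: FeffermanClay2006, (C)].
-/

noncomputable section

namespace Summit.NavierStokesRegularity.FluidComputer

open Set MeasureTheory Filter Topology Function TopologicalSpace Metric
open scoped ENNReal ContDiff NNReal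
open Literature.Analysis.FluidPDE
open Summit.NavierStokesRegularity.NavierStokesRegularity
open Summit.NavierStokesRegularity.FluidComputer.PalasekTowerClayBridge

/-- The radii `rₙ = min r₂ (1/(n+1))`: positive, `≤ r₂`, antitone, `→ 0`. [folklore] -/
theorem radii_aux {r₂ : ℝ} (hr₂ : 0 < r₂) :
    (∀ n : ℕ, 0 < min r₂ (1 / ((n : ℝ) + 1))) ∧ (∀ n : ℕ, min r₂ (1 / ((n : ℝ) + 1)) ≤ r₂) ∧
      Antitone (fun n : ℕ => min r₂ (1 / ((n : ℝ) + 1))) ∧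
        Tendsto (fun n : ℕ => min r₂ (1 / ((n : ℝ) + 1))) atTop (𝓝 0) := by
  refine ⟨fun n => lt_min hr₂ (by positivity), fun n => min_le_left _ _, ?_, ?_⟩
  · intro m n hmn
    refine min_le_min_left _ (one_div_le_one_div_of_le (by positivity) ?_)
    have : (m : ℝ) ≤ n := by exact_mod_cast hmn
    linarith
  · have h := (tendsto_one_div_add_atTop_nhds_zero_nat).min (tendsto_const_nhds (x := r₂))
    rw [min_eq_left hr₂.le] at h
    simpa only [min_comm] using h

/-- The extended diameter of a closed ball of radius `ρ` is at most `2ρ`. [folklore] -/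
theorem ediam_closedBall_le_ofReal (x : EuclideanSpace ℝ (Fin 3)) (ρ : ℝ) :
    Metric.ediam (closedBall x ρ) ≤ ENNReal.ofReal (2 * ρ) := by
  refine Metric.ediam_le fun a ha b hb => ?_
  rw [edist_dist]
  refine ENNReal.ofReal_le_ofReal ?_
  rw [mem_closedBall] at ha hb
  linarith [dist_triangle_right a b x, dist_comm b x]

namespace ClayBlowup

variable {ν : ℝ} (X : ClayBlowup ν)

/-- **THE SINGULAR SLICE OF A CLAY BLOW-UP HAS LEBESGUE MEASURE ZERO** (`ν > 0`): at scale `rₙ` the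
slice is covered by `#Pₙ` closed balls of radius `2rₙ` with `#Pₙ · ε³rₙ²/2 ≤ m(rₙ) → 0`, so its volume
is `≤ m(rₙ) · 16|B₁| rₙ / ε³ ≤ m(rₙ) · const → 0`. No named fact.
[cite: CaffarelliKohnNirenberg1982, §6] -/
theorem volume_singularSlice_eq_zero (hν : 0 < ν) :
    volume {x₀ : EuclideanSpace ℝ (Fin 3) | ¬ IsBackwardBoundedAt X.u X.T x₀} = 0 := by
  obtain ⟨ε, r₂, hε, hr₂, hnet⟩ := X.exists_finite_net_singularSlice hν
  obtain ⟨hρpos, hρle, hρanti, hρ0⟩ := radii_aux hr₂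
  set ρ : ℕ → ℝ := fun n => min r₂ (1 / ((n : ℝ) + 1))
  set S : Set (EuclideanSpace ℝ (Fin 3)) := {x₀ | ¬ IsBackwardBoundedAt X.u X.T x₀}
  -- the strip masses along `ρₙ²`
  set m : ℕ → ℝ≥0∞ := fun n => ∫⁻ z in (Ioo 0 X.T ×ˢ (univ : Set (EuclideanSpace ℝ (Fin 3)))) ∩
      {z : ℝ × EuclideanSpace ℝ (Fin 3) | X.T - ρ n ^ 2 < z.1},
    (‖X.u z.1 z.2‖ₑ ^ (3 : ℕ) + 2 * ‖normalisedPressure (X.u z.1) z.2‖ₑ ^ (3 / 2 : ℝ) +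
      2 * (1 : ℝ≥0∞)⁻¹ ^ (1 / 2 : ℝ) * ‖forcePotential (X.f z.1) z.2‖ₑ ^ 2)
  have hm0 : Tendsto m atTop (𝓝 0) := by
    have hanti : Antitone fun n => ρ n ^ 2 := fun a b hab =>
      pow_le_pow_left₀ (hρpos b).le (hρanti hab) 2
    have h0 : Tendsto (fun n => ρ n ^ 2) atTop (𝓝 0) := by
      simpa using hρ0.pow 2
    exact X.tendsto_stripMass hν hanti h0
  -- the unit-ball volume and the constant
  set V₁e : ℝ≥0∞ := volume (ball (0 : EuclideanSpace ℝ (Fin 3)) 1) with hV₁e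
  have hV₁top : V₁e ≠ ⊤ := measure_ball_lt_top.ne
  set K : ℝ≥0∞ := ENNReal.ofReal (16 * r₂ / ε ^ 3) * V₁e with hK
  have hKt : K ≠ ⊤ := ENNReal.mul_ne_top ENNReal.ofReal_ne_top hV₁top
  -- the bound at each scale
  have hbound : ∀ n, volume S ≤ m n * K := by
    intro n
    obtain ⟨P, hP, hcov, hpack⟩ := hnet (ρ n) (hρpos n) (hρle n)
    have hρn := hρpos n
    -- `|B̄(x, 2ρ)| = ofReal((2ρ)³) V₁ = ofReal(ε³ρ²/2) · ofReal(16ρ/ε³) · V₁`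
    have hball : ∀ x : EuclideanSpace ℝ (Fin 3), volume (closedBall x (2 * ρ n)) =
        ENNReal.ofReal (ε ^ 3 * ρ n ^ 2 / 2) * (ENNReal.ofReal (16 * ρ n / ε ^ 3) * V₁e) := by
      intro x
      rw [Measure.addHaar_closedBall _ _ (by positivity), finrank_euclideanSpace_fin, ← mul_assoc,
        ← ENNReal.ofReal_mul (by positivity)]
      congr 2
      field_simp
      ring
    calc volume S ≤ volume (⋃ x ∈ P, closedBall x (2 * ρ n)) := measure_mono hcov
      _ ≤ ∑ x ∈ P, volume (closedBall x (2 * ρ n)) := measure_biUnion_finset_le _ _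
      _ = (P.card : ℝ≥0∞) * (ENNReal.ofReal (ε ^ 3 * ρ n ^ 2 / 2) *
            (ENNReal.ofReal (16 * ρ n / ε ^ 3) * V₁e)) := by
          rw [Finset.sum_congr rfl fun x _ => hball x, Finset.sum_const, nsmul_eq_mul]
      _ = (P.card : ℝ≥0∞) * ENNReal.ofReal (ε ^ 3 * ρ n ^ 2 / 2) *
            (ENNReal.ofReal (16 * ρ n / ε ^ 3) * V₁e) := by rw [mul_assoc]
      _ ≤ m n * (ENNReal.ofReal (16 * ρ n / ε ^ 3) * V₁e) := mul_le_mul' hpack le_rfl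
      _ ≤ m n * K := by
          rw [hK]
          gcongr
          exact hρle n
  -- the limit
  have hlim : Tendsto (fun n => m n * K) atTop (𝓝 0) := by
    have := ENNReal.Tendsto.mul_const hm0 (Or.inr hKt)
    rwa [zero_mul] at this
  exact nonpos_iff_eq_zero.1 (ge_of_tendsto' hlim hbound)

/-- **THE SINGULAR SLICE OF A CLAY BLOW-UP HAS TWO-DIMENSIONAL HAUSDORFF MEASURE ZERO** (`ν > 0`):
`μH[2] {x₀ | ¬ IsBackwardBoundedAt u T x₀} = 0`. The covers `{B̄(x, 2rₙ)}_{x ∈ Pₙ}` have diameters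
`≤ 4rₙ → 0` and `∑ diam² ≤ #Pₙ · 16rₙ² = (#Pₙ · ε³rₙ²/2) · 32/ε³ ≤ 32 m(rₙ)/ε³ → 0`
(`hausdorffMeasure_le_liminf_sum`). In particular NO breakdown scenario for Fefferman's (C) has a
sheet-like (two-dimensional) or volumetric singular set at its blow-up time. No named fact.
[cite: CaffarelliKohnNirenberg1982, §6] [cite: RobinsonRodrigoSadowski2016, Thm. 16.2] -/
theorem hausdorffMeasure_two_singularSlice_eq_zero (hν : 0 < ν) :
    μH[2] {x₀ : EuclideanSpace ℝ (Fin 3) | ¬ IsBackwardBoundedAt X.u X.T x₀} = 0 := by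
  obtain ⟨ε, r₂, hε, hr₂, hnet⟩ := X.exists_finite_net_singularSlice hν
  obtain ⟨hρpos, hρle, hρanti, hρ0⟩ := radii_aux hr₂
  set ρ : ℕ → ℝ := fun n => min r₂ (1 / ((n : ℝ) + 1))
  set S : Set (EuclideanSpace ℝ (Fin 3)) := {x₀ | ¬ IsBackwardBoundedAt X.u X.T x₀}
  set m : ℕ → ℝ≥0∞ := fun n => ∫⁻ z in (Ioo 0 X.T ×ˢ (univ : Set (EuclideanSpace ℝ (Fin 3)))) ∩
      {z : ℝ × EuclideanSpace ℝ (Fin 3) | X.T - ρ n ^ 2 < z.1},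
    (‖X.u z.1 z.2‖ₑ ^ (3 : ℕ) + 2 * ‖normalisedPressure (X.u z.1) z.2‖ₑ ^ (3 / 2 : ℝ) +
      2 * (1 : ℝ≥0∞)⁻¹ ^ (1 / 2 : ℝ) * ‖forcePotential (X.f z.1) z.2‖ₑ ^ 2)
  have hm0 : Tendsto m atTop (𝓝 0) := by
    have hanti : Antitone fun n => ρ n ^ 2 := fun a b hab =>
      pow_le_pow_left₀ (hρpos b).le (hρanti hab) 2
    have h0 : Tendsto (fun n => ρ n ^ 2) atTop (𝓝 0) := by
      simpa using hρ0.pow 2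
    exact X.tendsto_stripMass hν hanti h0
  -- the nets
  choose P hP hcov hpack using fun n => hnet (ρ n) (hρpos n) (hρle n)
  -- the covering bound for `μH[2]`
  have hr : Tendsto (fun n => ENNReal.ofReal (4 * ρ n)) atTop (𝓝 0) := by
    have h := ENNReal.tendsto_ofReal (hρ0.const_mul 4)
    rwa [mul_zero, ENNReal.ofReal_zero] at h
  have hH := Measure.hausdorffMeasure_le_liminf_sum (ι := fun n => ↥(P n)) 2 S
    (r := fun n => ENNReal.ofReal (4 * ρ n)) hr
    (fun n (i : ↥(P n)) => closedBall (i : EuclideanSpace ℝ (Fin 3)) (2 * ρ n))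
    (Eventually.of_forall fun n i => by
      have h := ediam_closedBall_le_ofReal (i : EuclideanSpace ℝ (Fin 3)) (2 * ρ n)
      have e : (2 * (2 * ρ n)) = 4 * ρ n := by ring
      rwa [e] at h)
    (Eventually.of_forall fun n => by
      intro y hy
      obtain ⟨x, hx, hyx⟩ := mem_iUnion₂.1 (hcov n hy)
      exact mem_iUnion.2 ⟨⟨x, hx⟩, hyx⟩)
  -- the sums are `≤ 32 m(ρₙ)/ε³ → 0`
  set K : ℝ≥0∞ := ENNReal.ofReal (32 / ε ^ 3) with hK
  have hKt : K ≠ ⊤ := ENNReal.ofReal_ne_top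
  have hsum : ∀ n, (∑ i : ↥(P n),
      Metric.ediam (closedBall (i : EuclideanSpace ℝ (Fin 3)) (2 * ρ n)) ^ (2 : ℝ)) ≤ m n * K := by
    intro n
    have hρn := hρpos n
    have h1 : ∀ i : ↥(P n), Metric.ediam (closedBall (i : EuclideanSpace ℝ (Fin 3)) (2 * ρ n)) ^
        (2 : ℝ) ≤ ENNReal.ofReal ((4 * ρ n) ^ 2) := by
      intro i
      have h := ediam_closedBall_le_ofReal (i : EuclideanSpace ℝ (Fin 3)) (2 * ρ n)
      have e : (2 * (2 * ρ n)) = 4 * ρ n := by ring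
      rw [e] at h
      calc _ ≤ ENNReal.ofReal (4 * ρ n) ^ (2 : ℝ) := ENNReal.rpow_le_rpow h (by norm_num)
        _ = ENNReal.ofReal ((4 * ρ n) ^ 2) := by
            rw [ENNReal.rpow_two, ← ENNReal.ofReal_pow (by positivity)]
    have e2 : ENNReal.ofReal ((4 * ρ n) ^ 2) = ENNReal.ofReal (ε ^ 3 * ρ n ^ 2 / 2) * K := by
      rw [hK, ← ENNReal.ofReal_mul (by positivity)]
      congr 1
      field_simp
      ring
    calc (∑ i : ↥(P n), Metric.ediam (closedBall (i : EuclideanSpace ℝ (Fin 3)) (2 * ρ n)) ^ (2 : ℝ))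
        ≤ ∑ _i : ↥(P n), ENNReal.ofReal ((4 * ρ n) ^ 2) := Finset.sum_le_sum fun i _ => h1 i
      _ = ((P n).card : ℝ≥0∞) * ENNReal.ofReal ((4 * ρ n) ^ 2) := by
          rw [Finset.sum_const, Finset.card_univ, Fintype.card_coe, nsmul_eq_mul]
      _ = ((P n).card : ℝ≥0∞) * ENNReal.ofReal (ε ^ 3 * ρ n ^ 2 / 2) * K := by
          rw [e2, mul_assoc]
      _ ≤ m n * K := mul_le_mul' (hpack n) le_rfl
  have hlim : Tendsto (fun n => m n * K) atTop (𝓝 0) := by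
    have := ENNReal.Tendsto.mul_const hm0 (Or.inr hKt)
    rwa [zero_mul] at this
  have hlim' : liminf (fun n => m n * K) atTop = 0 := hlim.liminf_eq
  refine nonpos_iff_eq_zero.1 (hH.trans ?_)
  rw [← hlim']
  exact liminf_le_liminf (Eventually.of_forall hsum)

end ClayBlowup

namespace DesignedBlowup

variable {ν : ℝ} (D : DesignedBlowup ν)

/-- **The singular slice of a designed blow-up is Lebesgue-null** (`ν > 0`; `toClayBlowup`).
[cite: CaffarelliKohnNirenberg1982, §6] -/
theorem volume_singularSlice_eq_zero (hν : 0 < ν) :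
    volume {x₀ : EuclideanSpace ℝ (Fin 3) | ¬ IsBackwardBoundedAt D.u D.T x₀} = 0 :=
  D.toClayBlowup.volume_singularSlice_eq_zero hν

/-- **The singular slice of a designed blow-up has two-dimensional Hausdorff measure zero** (`ν > 0`;
`toClayBlowup`): no sheet-like or volumetric first-time singularities.
[cite: CaffarelliKohnNirenberg1982, §6] -/
theorem hausdorffMeasure_two_singularSlice_eq_zero (hν : 0 < ν) :
    μH[2] {x₀ : EuclideanSpace ℝ (Fin 3) | ¬ IsBackwardBoundedAt D.u D.T x₀} = 0 :=
  D.toClayBlowup.hausdorffMeasure_two_singularSlice_eq_zero hν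

end DesignedBlowup

end Summit.NavierStokesRegularity.FluidComputer

end
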